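import Summits.AtomisticToContinuum.Crystallization.Theorems.HullExactificationCascadeZeroDefectDensityCensusFrameAux
import HarnessLib

/-!
# Tangent-plane windows at a shell vertex — part 2/2: the registered stub
# (route `HullExactificationCascade`, crux `ZeroDefectDensity`, stmt-AtomisticToContinuum-12086;
# line `birth`, stub `stub_censusFrame`, registered signature verbatim)

Datum: a centre `u` and twelve points `p : Fin 12 → ℝ³` with `dist u (p i) ∈ [1 - η, 1 + η]`,
`η = 1/4000`, pairwise distances either in `[1 - η, 1 + η]` (soft contact) or `≥ 7/5`;
directions `dir i = ‖p i - u‖⁻¹ • (p i - u)` and the open cap cones `capCone (dir i) (893/1250)`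
(`Literature.Geometry.DiscreteGeometry.capCone a c = {x | c‖x‖ < ⟪a, x⟫} ∩ ball 0 1`).  The stub
supplies the three metric facts the Voronoi-type census on the sphere of directions needs:

1. PIGEONHOLE.  A shell point with four soft contacts has two soft contact pairs among them.  In
   lead c4's cylindrical frame about the axis `u - p i` (`link_frame`, `link_vpoint`) the planar
   unit directions of the contacts are pairwise `≥ arccos 0.344 = 69.88°` apart (worker K1's
   `sdeg_vany`) and a non-contact pair (`≥ 7/5 ≥ 131/100`) is `≥ arccos (-0.136) = 97.8°` apart
   (`link_vfar`); the four cyclic gaps of the sorted arguments sum to `360°` while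
   `3 · 97.8° + 69.88° > 360°`, so two gaps are contact pairs (part 1's `cf_four_directions`;
   here `cf_four_contacts`).
2. TRIPLES.  Among three soft contacts of `p i` some pair is not a contact pair: three planar
   unit vectors have vanishing Gram determinant, impossible with all planar cosines in
   `[0.323, 0.344]` (`sdeg_vcontactLower`, part 1's `cf_three_directions`; here
   `cf_three_contacts`); that pair is `≥ 7/5` apart, so its two cap cones are disjoint and so are
   the regions of the cap of `dir i` beyond the two bisectors (part 1's `cf_far_beyond`).
3. FAR PAIRS.  Two shell points not in soft contact are `≥ 7/5` apart and have disjoint cap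
   cones (part 1's `cf_far_capCone`).

Mathlib + the landed toolkits of c4 (`link_frame`, `link_vpoint`, `link_vfar`), K1 (`sdeg_vany`,
`sdeg_vcontactLower`) and part 1; no named fact is used.
-/

noncomputable section

namespace Summit.AtomisticToContinuum.Crystallization.Theorems.ZeroDefectDensityBirth

open Real
open scoped InnerProductSpace
open Literature.Geometry.DiscreteGeometry (capCone)

/-! ## Part G. Soft contacts of a shell point in the frame -/

/-- **A soft contact in the frame of a shell point.**  For the centre `u`, a shell point `v` and a
common soft contact `n` (the three distances in `[1 - η, 1 + η]`, `η = 1/4000`), the vector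
`n - v` has, in c4's cylindrical frame about the axis `u - v` (`link_frame`), axis component
`α ∈ [0.497, 0.503]`, squared planar radius `ρ² ∈ [0.7449, 0.755]`, `ρ > 0` and
`‖n - v‖² ∈ [0.998001, 1.002001]` (`link_vpoint` at `η = 1/4000 ≤ 1/1000`). [folklore] -/
theorem cf_vpoint {u v n : EuclideanSpace ℝ (Fin 3)} {ρ α : EuclideanSpace ℝ (Fin 3) → ℝ}
    (hα : ∀ q, α q * ‖u - v‖ = ⟪q, u - v⟫_ℝ) (hρ0 : ∀ q, 0 ≤ ρ q)
    (hρ : ∀ q, ρ q ^ 2 = ‖q‖ ^ 2 - α q ^ 2)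
    (hv : 1 - 1 / 4000 ≤ dist u v ∧ dist u v ≤ 1 + 1 / 4000)
    (hn : 1 - 1 / 4000 ≤ dist u n ∧ dist u n ≤ 1 + 1 / 4000)
    (hvn : 1 - 1 / 4000 ≤ dist v n ∧ dist v n ≤ 1 + 1 / 4000) :
    0.497 ≤ α (n - v) ∧ α (n - v) ≤ 0.503 ∧ 0.7449 ≤ ρ (n - v) ^ 2 ∧ ρ (n - v) ^ 2 ≤ 0.755 ∧
      0 < ρ (n - v) ∧ 0.998001 ≤ ‖n - v‖ ^ 2 ∧ ‖n - v‖ ^ 2 ≤ 1.002001 := by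
  obtain ⟨h1, h2⟩ := hv
  obtain ⟨h3, h4⟩ := hn
  obtain ⟨h5, h6⟩ := hvn
  rw [dist_eq_norm] at h1 h2 h3 h4 h5 h6
  rw [norm_sub_rev] at h1 h2
  exact link_vpoint hα hρ0 hρ (by norm_num : (0 : ℝ) ≤ 1 / 4000)
    (by norm_num : (1 / 4000 : ℝ) ≤ 1 / 1000) h1 h2 h3 h4 h5 h6

/-- **Four soft contacts of a shell point contain two contact pairs.**  For the centre `u`, a
shell point `v` and four common soft contacts `n₀, …, n₃` of `u` and `v`, pairwise `≥ 1 - η` apart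
and each pair either `≤ 1 + η` or `≥ 7/5` apart: two distinct pairs `{k, l} ≠ {k', l'}` are soft
contact pairs.  In the frame about `u - v` the four planar unit directions are pairwise `≥ 69.88°`
apart (`sdeg_vany`), so by `cf_four_directions` two distinct pairs have planar cosine `> -0.136`,
which excludes `≥ 131/100` (`link_vfar`), hence `≥ 7/5`. [folklore] -/
theorem cf_four_contacts (u v : EuclideanSpace ℝ (Fin 3))
    (n : Fin 4 → EuclideanSpace ℝ (Fin 3))
    (hv : 1 - 1 / 4000 ≤ dist u v ∧ dist u v ≤ 1 + 1 / 4000)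
    (hn : ∀ k, 1 - 1 / 4000 ≤ dist u (n k) ∧ dist u (n k) ≤ 1 + 1 / 4000)
    (hvn : ∀ k, 1 - 1 / 4000 ≤ dist v (n k) ∧ dist v (n k) ≤ 1 + 1 / 4000)
    (hnn : ∀ k l, k ≠ l → 1 - 1 / 4000 ≤ dist (n k) (n l) ∧
      (dist (n k) (n l) ≤ 1 + 1 / 4000 ∨ 7 / 5 ≤ dist (n k) (n l))) :
    ∃ k l k' l' : Fin 4, k ≠ l ∧ k' ≠ l' ∧ ¬(k = k' ∧ l = l') ∧ ¬(k = l' ∧ l = k') ∧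
      dist (n k) (n l) ≤ 1 + 1 / 4000 ∧ dist (n k') (n l') ≤ 1 + 1 / 4000 := by
  have ha : u - v ≠ 0 := by
    intro h
    have h1 := hv.1
    rw [dist_eq_norm, h, norm_zero] at h1
    norm_num at h1
  obtain ⟨x, y, ρ, α, hα, hρ0, hρ, hxy, hid⟩ := link_frame (u - v) ha
  have P : ∀ k, 0.497 ≤ α (n k - v) ∧ α (n k - v) ≤ 0.503 ∧ 0.7449 ≤ ρ (n k - v) ^ 2 ∧
      ρ (n k - v) ^ 2 ≤ 0.755 ∧ 0 < ρ (n k - v) ∧ 0.998001 ≤ ‖n k - v‖ ^ 2 ∧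
      ‖n k - v‖ ^ 2 ≤ 1.002001 := fun k => cf_vpoint hα hρ0 hρ hv (hn k) (hvn k)
  have hfar : ∀ k l, k ≠ l →
      -0.136 < x (n k - v) * x (n l - v) + y (n k - v) * y (n l - v) →
      dist (n k) (n l) ≤ 1 + 1 / 4000 := by
    intro k l hkl hgt
    obtain ⟨-, h2 | h2⟩ := hnn k l hkl
    · exact h2
    · exfalso
      rw [dist_eq_norm] at h2
      have := link_vfar hid (P k) (P l) (by linarith)
      linarith
  have hC : ∀ k l, k ≠ l →
      x (n k - v) * x (n l - v) + y (n k - v) * y (n l - v) ≤ 0.344 := by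
    intro k l hkl
    obtain ⟨h1, -⟩ := hnn k l hkl
    rw [dist_eq_norm] at h1
    exact sdeg_vany hid (P k) (P l) (by linarith)
  obtain ⟨k, l, k', l', hkl, hkl', hne1, hne2, hgt, hgt'⟩ :=
    cf_four_directions (fun k => x (n k - v)) (fun k => y (n k - v))
      (fun k => hxy _ (P k).2.2.2.2.1) hC
  exact ⟨k, l, k', l', hkl, hkl', hne1, hne2, hfar k l hkl hgt, hfar k' l' hkl' hgt'⟩

/-- **Three soft contacts of a shell point contain a non-contact pair.**  For the centre `u`, a
shell point `v` and three common soft contacts `n₁, n₂, n₃` pairwise `≥ 1 - η` apart, some pair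
is NOT a soft contact pair: in the frame about `u - v` the planar directions are pairwise
`≥ 69.88°` apart (`sdeg_vany`), so some pair has planar cosine `< 0.323` (`cf_three_directions`),
which a contact pair has not (`sdeg_vcontactLower`). [folklore] -/
theorem cf_three_contacts {u v n₁ n₂ n₃ : EuclideanSpace ℝ (Fin 3)}
    (hv : 1 - 1 / 4000 ≤ dist u v ∧ dist u v ≤ 1 + 1 / 4000)
    (hn₁ : 1 - 1 / 4000 ≤ dist u n₁ ∧ dist u n₁ ≤ 1 + 1 / 4000)
    (hn₂ : 1 - 1 / 4000 ≤ dist u n₂ ∧ dist u n₂ ≤ 1 + 1 / 4000)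
    (hn₃ : 1 - 1 / 4000 ≤ dist u n₃ ∧ dist u n₃ ≤ 1 + 1 / 4000)
    (hvn₁ : 1 - 1 / 4000 ≤ dist v n₁ ∧ dist v n₁ ≤ 1 + 1 / 4000)
    (hvn₂ : 1 - 1 / 4000 ≤ dist v n₂ ∧ dist v n₂ ≤ 1 + 1 / 4000)
    (hvn₃ : 1 - 1 / 4000 ≤ dist v n₃ ∧ dist v n₃ ≤ 1 + 1 / 4000)
    (h₁₂ : 1 - 1 / 4000 ≤ dist n₁ n₂) (h₁₃ : 1 - 1 / 4000 ≤ dist n₁ n₃)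
    (h₂₃ : 1 - 1 / 4000 ≤ dist n₂ n₃) :
    ¬ dist n₁ n₂ ≤ 1 + 1 / 4000 ∨ ¬ dist n₁ n₃ ≤ 1 + 1 / 4000 ∨
      ¬ dist n₂ n₃ ≤ 1 + 1 / 4000 := by
  have ha : u - v ≠ 0 := by
    intro h
    have h1 := hv.1
    rw [dist_eq_norm, h, norm_zero] at h1
    norm_num at h1
  obtain ⟨x, y, ρ, α, hα, hρ0, hρ, hxy, hid⟩ := link_frame (u - v) ha
  have P₁ := cf_vpoint hα hρ0 hρ hv hn₁ hvn₁
  have P₂ := cf_vpoint hα hρ0 hρ hv hn₂ hvn₂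
  have P₃ := cf_vpoint hα hρ0 hρ hv hn₃ hvn₃
  rw [dist_eq_norm] at h₁₂ h₁₃ h₂₃
  have hlow : ∀ {n m : EuclideanSpace ℝ (Fin 3)},
      (0.497 ≤ α (n - v) ∧ α (n - v) ≤ 0.503 ∧ 0.7449 ≤ ρ (n - v) ^ 2 ∧
        ρ (n - v) ^ 2 ≤ 0.755 ∧ 0 < ρ (n - v) ∧ 0.998001 ≤ ‖n - v‖ ^ 2 ∧
        ‖n - v‖ ^ 2 ≤ 1.002001) →
      (0.497 ≤ α (m - v) ∧ α (m - v) ≤ 0.503 ∧ 0.7449 ≤ ρ (m - v) ^ 2 ∧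
        ρ (m - v) ^ 2 ≤ 0.755 ∧ 0 < ρ (m - v) ∧ 0.998001 ≤ ‖m - v‖ ^ 2 ∧
        ‖m - v‖ ^ 2 ≤ 1.002001) →
      1 - 1 / 4000 ≤ ‖n - m‖ → x (n - v) * x (m - v) + y (n - v) * y (m - v) < 0.323 →
      ¬ dist n m ≤ 1 + 1 / 4000 := by
    intro n m hn hm h1 hlt hle
    rw [dist_eq_norm] at hle
    have := sdeg_vcontactLower hid hn hm (by linarith) (by linarith)
    linarith
  rcases cf_three_directions (hxy _ P₁.2.2.2.2.1) (hxy _ P₂.2.2.2.2.1) (hxy _ P₃.2.2.2.2.1)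
      (sdeg_vany hid P₁ P₂ (by linarith)) (sdeg_vany hid P₁ P₃ (by linarith))
      (sdeg_vany hid P₂ P₃ (by linarith)) with h | h | h
  · exact Or.inl (hlow P₁ P₂ h₁₂ h)
  · exact Or.inr (Or.inl (hlow P₁ P₃ h₁₃ h))
  · exact Or.inr (Or.inr (hlow P₂ P₃ h₂₃ h))

/-! ## Part H. The registered stub -/

/-- **STUB K2b of the birth line — tangent-plane windows at a vertex** (registered signature
verbatim).  In a `1/4000`-soft gapped twelve-shell `p` about `u` (soft contact
`= dist ≤ 1 + 1/4000`, otherwise `≥ 7/5`; `dir i = ‖p i - u‖⁻¹ • (p i - u)`):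
(1) a shell point with exactly four soft contacts has at least two soft contact pairs among them
(`cf_four_contacts`: azimuthal pigeonhole), so the set of increasing such pairs has `ncard ≥ 2`;
(2) among three distinct soft contacts `j, k, l` of `i` some pair is not a contact pair
(`cf_three_contacts`), hence `≥ 7/5` apart, and then the regions of the cap cone of `dir i`
(parameter `893/1250`) beyond the bisectors towards those two are disjoint (`cf_far_beyond`);
(3) two shell points that are not in soft contact are `≥ 7/5` apart, their direction cosine is
`≤ 2 (893/1250)² - 1`, and their cap cones are disjoint (`cf_far_capCone`).
The hypothesis "at most four contacts" is not used. [folklore] -/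
theorem stub_censusFrame : ∀ (u : EuclideanSpace ℝ (Fin 3)) (p : Fin 12 → EuclideanSpace ℝ (Fin 3)), (∀ i : Fin 12, 1 - 1 / 4000 ≤ dist u (p i) ∧ dist u (p i) ≤ 1 + 1 / 4000) → (∀ i j : Fin 12, i ≠ j → 1 - 1 / 4000 ≤ dist (p i) (p j) ∧ (dist (p i) (p j) ≤ 1 + 1 / 4000 ∨ 7 / 5 ≤ dist (p i) (p j))) → (∀ i : Fin 12, {j : Fin 12 | j ≠ i ∧ dist (p i) (p j) ≤ 1 + 1 / 4000}.ncard ≤ 4) → (∀ i : Fin 12, {j : Fin 12 | j ≠ i ∧ dist (p i) (p j) ≤ 1 + 1 / 4000}.ncard = 4 → 2 ≤ {q : Fin 12 × Fin 12 | q.1 < q.2 ∧ q.1 ≠ i ∧ q.2 ≠ i ∧ dist (p i) (p q.1) ≤ 1 + 1 / 4000 ∧ dist (p i) (p q.2) ≤ 1 + 1 / 4000 ∧ dist (p q.1) (p q.2) ≤ 1 + 1 / 4000}.ncard) ∧ (∀ i j k l : Fin 12, j ≠ i → k ≠ i → l ≠ i → j ≠ k → j ≠ l → k ≠ l → dist (p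 i) (p j) ≤ 1 + 1 / 4000 → dist (p i) (p k) ≤ 1 + 1 / 4000 → dist (p i) (p l) ≤ 1 + 1 / 4000 → (Literature.Geometry.DiscreteGeometry.capCone (‖p i - u‖⁻¹ • (p i - u)) (893 / 1250) ∩ {x : EuclideanSpace ℝ (Fin 3) | inner ℝ (‖p i - u‖⁻¹ • (p i - u)) x < inner ℝ (‖p j - u‖⁻¹ • (p j - u)) x} ∩ {x : EuclideanSpace ℝ (Fin 3) | inner ℝ (‖p i - u‖⁻¹ • (p i - u)) x < inner ℝ (‖p k - u‖⁻¹ • (p k - u)) x} = ∅ ∨ Literature.Geometry.DiscreteGeometry.capCone (‖p i - u‖⁻¹ • (p i - u)) (893 / 1250) ∩ {x : EuclideanSpace ℝ (Fin 3) | inner ℝ (‖p i - u‖⁻¹ • (p i - u)) x < inner ℝ (‖p j - u‖⁻¹ • (p j - u)) x} ∩ {x : EuclideanSpace ℝ (Fin 3) | inner ℝ (‖p i - u‖⁻¹ • (p i - u)) x < inner ℝ (‖p l - u‖⁻¹ • (p l - u)) x} = ∅ ∨ Literature.Geometry.DiscreteGeometry.capCone (‖p i - u‖⁻¹ • (p i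 - u)) (893 / 1250) ∩ {x : EuclideanSpace ℝ (Fin 3) | inner ℝ (‖p i - u‖⁻¹ • (p i - u)) x < inner ℝ (‖p k - u‖⁻¹ • (p k - u)) x} ∩ {x : EuclideanSpace ℝ (Fin 3) | inner ℝ (‖p i - u‖⁻¹ • (p i - u)) x < inner ℝ (‖p l - u‖⁻¹ • (p l - u)) x} = ∅)) ∧ (∀ i j : Fin 12, i ≠ j → ¬ dist (p i) (p j) ≤ 1 + 1 / 4000 → Literature.Geometry.DiscreteGeometry.capCone (‖p i - u‖⁻¹ • (p i - u)) (893 / 1250) ∩ Literature.Geometry.DiscreteGeometry.capCone (‖p j - u‖⁻¹ • (p j - u)) (893 / 1250) = ∅) := by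
  intro u p hu hp _h4
  have Csymm : ∀ a b, dist (p a) (p b) ≤ 1 + 1 / 4000 → dist (p b) (p a) ≤ 1 + 1 / 4000 :=
    fun a b h => by rwa [dist_comm]
  refine ⟨fun i hi => ?_, fun i j k l hji hki hli hjk hjl hkl hij hik hil => ?_,
    fun i j hij hC => ?_⟩
  · -- (1) four contacts: extract them as `e : Fin 4 ≃ F`, `F ⊆` the contact set
    set T : Set (Fin 12) := {j : Fin 12 | j ≠ i ∧ dist (p i) (p j) ≤ 1 + 1 / 4000} with hT
    have hfin : T.Finite := T.toFinite
    rw [Set.ncard_eq_toFinset_card T hfin] at hi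
    obtain ⟨F, hF, hcard⟩ :=
      Finset.exists_subset_card_eq (show 4 ≤ hfin.toFinset.card by omega)
    set e := (Finset.equivFinOfCardEq hcard).symm with he
    have hmem : ∀ k, ((e k : F) : Fin 12) ≠ i ∧
        dist (p i) (p ((e k : F) : Fin 12)) ≤ 1 + 1 / 4000 := fun k => by
      have := hF (e k).2
      simpa [hT] using this
    have einj : ∀ k l, ((e k : F) : Fin 12) = e l → k = l := fun k l h' =>
      e.injective (Subtype.val_injective h')
    obtain ⟨k, l, k', l', hkl, hkl', hne1, hne2, hc, hc'⟩ :=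
      cf_four_contacts u (p i) (fun k => p (e k)) (hu i) (fun k => hu _)
        (fun k => ⟨(hp i _ (Ne.symm (hmem k).1)).1, (hmem k).2⟩)
        (fun k l hkl => hp _ _ (fun h' => hkl (einj k l h')))
    refine cf_two_le_ncard_pairs _
      (fun a b => a ≠ b ∧ a ≠ i ∧ b ≠ i ∧ dist (p i) (p a) ≤ 1 + 1 / 4000 ∧
        dist (p i) (p b) ≤ 1 + 1 / 4000 ∧ dist (p a) (p b) ≤ 1 + 1 / 4000)
      ?_ ?_ (a := e k) (b := e l) (a' := e k') (b' := e l')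
      (fun h' => hkl (einj _ _ h')) (fun h' => hkl' (einj _ _ h'))
      (fun h' => hne1 ⟨einj _ _ h'.1, einj _ _ h'.2⟩)
      (fun h' => hne2 ⟨einj _ _ h'.1, einj _ _ h'.2⟩)
      ⟨fun h' => hkl (einj _ _ h'), (hmem k).1, (hmem l).1, (hmem k).2, (hmem l).2, hc⟩
      ⟨fun h' => hkl' (einj _ _ h'), (hmem k').1, (hmem l').1, (hmem k').2, (hmem l').2,
        hc'⟩
    · rintro a b ⟨h1, h2, h3, h4, h5, h6⟩
      exact ⟨h1.symm, h3, h2, h5, h4, Csymm _ _ h6⟩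
    · rintro a b ⟨-, h2, h3, h4, h5, h6⟩ hlt
      exact ⟨hlt, h2, h3, h4, h5, h6⟩
  · -- (2) triples
    rcases cf_three_contacts (hu i) (hu j) (hu k) (hu l) ⟨(hp i j (Ne.symm hji)).1, hij⟩
        ⟨(hp i k (Ne.symm hki)).1, hik⟩ ⟨(hp i l (Ne.symm hli)).1, hil⟩ (hp j k hjk).1
        (hp j l hjl).1 (hp k l hkl).1 with h | h | h
    · exact Or.inl (cf_far_beyond _ (hu j) (hu k) ((hp j k hjk).2.resolve_left h))
    · exact Or.inr (Or.inl
        (cf_far_beyond _ (hu j) (hu l) ((hp j l hjl).2.resolve_left h)))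
    · exact Or.inr (Or.inr
        (cf_far_beyond _ (hu k) (hu l) ((hp k l hkl).2.resolve_left h)))
  · -- (3) far pairs
    exact cf_far_capCone (hu i) (hu j) ((hp i j hij).2.resolve_left hC)

end Summit.AtomisticToContinuum.Crystallization.Theorems.ZeroDefectDensityBirth
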